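import Summits.AtomisticToContinuum.HydrodynamicLimit.Theorems.EnskogAdjointDualityAdjointEnskogTestFamilyRKernelCriticalPrep
import HarnessLib

/-!
# EnskogAdjointDuality / AdjointEnskogTestFamilyR — stub `kernelCritical` (K0)

The registered stub `stub_kernelCritical` of the line `refutation` of crux
`Summit.AtomisticToContinuum.HydrodynamicLimit.Theses.EnskogAdjointDuality.AdjointEnskogTestFamilyR`
(stmt-AtomisticToContinuum-11592): **criticality of the `ℓ = 0` sector**.  For the critical isotropic
weight `ϑ_R(E) = (1+E)⁻³ e^{-E/R}` (energy `E = |v|²`) with tail `Θ̄_R(x) = ∫_x^∞ ϑ_R`, the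
sphere-reduced dual hard-sphere kernel
`k_R(E) = 2 g_R(E) - n(√E) ϑ_R(E)`, `g_R(E) = π ∫_{-1}^{1} e^{-E(1-t²)/2} h(√E t) Θ̄_R(E t²) dt`,
satisfies `∫₀^∞ (1+E) √E |k_R(E)| dE ≤ 3460 π` uniformly in `R ≥ 1`, for every continuous `h` with
`0 ≤ h(a) - a₊ ≤ e^{-a²/2}` and every measurable loss profile `πu ≤ n(u) ≤ π√(u²+3)`.

Mechanism (this file): the positive part `(√E t)₊` of `h` lives on `t ∈ [0,1]`; one integration by
parts in `t` (`t e^{-E(1-t²)/2} = ∂_t e^{-E(1-t²)/2} / E`, `∂_t Θ̄_R(E t²) = -2Et ϑ_R(E t²)`) gives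
`2 g_R(E) = (2π/√E) Θ̄_R(E) - (2π/√E) Θ̄_R(0) e^{-E/2} + 4π√E K + 2π I_r` with
`E K ≤ 768 (1+E)⁻³` and `0 ≤ I_r ≤ e^{-E/2}`; the critical identity of the Prep file,
`2Θ̄_R(E) = Eϑ_R(E) + ϑ_R(E) - S`, `0 ≤ (1+E) S ≤ R⁻¹ e^{-E/R}`, cancels `(2π/√E)Θ̄_R(E)` against the
loss `π√E ϑ_R(E) ≤ n(√E)ϑ_R(E) ≤ π√(E+3) ϑ_R(E)`.  Every remainder is dominated by
`π (3075 (1+E)⁻² + 96 e^{-E/4})`, except the escaping mass `π R⁻¹ e^{-E/R}` of integral `π`.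
Measurability of the integrand comes from the everywhere-continuous version of the gain built with
`Θ̄_R ∘ (· ⊔ 0)`.
-/

noncomputable section

open MeasureTheory Set Filter Topology
open scoped Real Topology

namespace Summit.AtomisticToContinuum.HydrodynamicLimit.Theorems.EnskogAdjointDuality

section Gain

variable {R : ℝ} {ϑ Θ : ℝ → ℝ}

/-- Integration by parts in `t`:
`∫_0^1 Θ̄(E t²) t e^{-E(1-t²)/2} dt = Θ̄(E)/E - Θ̄(0) e^{-E/2}/E + 2 ∫_0^1 t ϑ(E t²) e^{-E(1-t²)/2} dt`
(`E > 0`). [folklore] -/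
theorem k2r_ref_K0_ibp (hR : 0 < R)
    (hϑ : ∀ E, ϑ E = ((1 + E) ^ 3)⁻¹ * Real.exp (-E / R))
    (hΘ : ∀ x, Θ x = ∫ E in Ioi x, ϑ E) {E : ℝ} (hE : 0 < E) :
    ∫ t in (0:ℝ)..1, Θ (E * t ^ 2) * (t * Real.exp (-(E * (1 - t ^ 2)) / 2))
      = Θ E * E⁻¹ - Θ 0 * (E⁻¹ * Real.exp (-E / 2))
        + 2 * ∫ t in (0:ℝ)..1, t * ϑ (E * t ^ 2) * Real.exp (-(E * (1 - t ^ 2)) / 2) := by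
  obtain ⟨hϑc, -⟩ := k2r_ref_K0_comp_sq_continuous hR hϑ hΘ hE.le
  have hU : ∀ t ∈ uIcc (0:ℝ) 1,
      HasDerivAt (fun t => Θ (E * t ^ 2)) (-ϑ (E * t ^ 2) * (E * (2 * t))) t := by
    intro t _
    have hin : HasDerivAt (fun t => E * t ^ 2) (E * (2 * t)) t := by
      refine (((hasDerivAt_id' t).fun_pow 2).const_mul E).congr_deriv ?_; ring
    exact (k2r_ref_K0_Theta_hasDerivAt hR hϑ hΘ (x := E * t ^ 2)
      (by nlinarith [sq_nonneg t, mul_nonneg hE.le (sq_nonneg t)])).comp t hin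
  have hV : ∀ t ∈ uIcc (0:ℝ) 1, HasDerivAt (fun t => E⁻¹ * Real.exp (-(E * (1 - t ^ 2)) / 2))
      (t * Real.exp (-(E * (1 - t ^ 2)) / 2)) t := by
    intro t _
    have hin : HasDerivAt (fun t => -(E * (1 - t ^ 2)) / 2) (E * t) t := by
      refine (((((hasDerivAt_id' t).fun_pow 2).const_sub 1).const_mul E).fun_neg.div_const 2
        ).congr_deriv ?_
      ring
    refine (hin.exp.const_mul E⁻¹).congr_deriv ?_
    field_simp
  have hU' : IntervalIntegrable (fun t => -ϑ (E * t ^ 2) * (E * (2 * t))) volume 0 1 :=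
    (Continuous.mul hϑc.neg (by fun_prop)).intervalIntegrable _ _
  have hV' : IntervalIntegrable (fun t => t * Real.exp (-(E * (1 - t ^ 2)) / 2)) volume 0 1 :=
    (by fun_prop : Continuous fun t => t * Real.exp (-(E * (1 - t ^ 2)) / 2)).intervalIntegrable _ _
  rw [intervalIntegral.integral_mul_deriv_eq_deriv_mul hU hV hU' hV']
  have hint : ∫ t in (0:ℝ)..1, -ϑ (E * t ^ 2) * (E * (2 * t))
      * (E⁻¹ * Real.exp (-(E * (1 - t ^ 2)) / 2))
      = (-2) * ∫ t in (0:ℝ)..1, t * ϑ (E * t ^ 2) * Real.exp (-(E * (1 - t ^ 2)) / 2) := by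
    rw [← intervalIntegral.integral_const_mul]
    refine intervalIntegral.integral_congr fun t _ => ?_
    field_simp
  rw [hint]
  simp

/-- The IBP remainder is lower order: with `K = ∫_0^1 t ϑ_R(E t²) e^{-E(1-t²)/2} dt`,
`0 ≤ K` and `E K ≤ 768 (1+E)⁻³` (`E > 0`, `R > 0`). [folklore] -/
theorem k2r_ref_K0_K_bound (hR : 0 < R)
    (hϑ : ∀ E, ϑ E = ((1 + E) ^ 3)⁻¹ * Real.exp (-E / R)) {E : ℝ} (hE : 0 < E) :
    0 ≤ ∫ t in (0:ℝ)..1, t * ϑ (E * t ^ 2) * Real.exp (-(E * (1 - t ^ 2)) / 2) ∧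
      E * ∫ t in (0:ℝ)..1, t * ϑ (E * t ^ 2) * Real.exp (-(E * (1 - t ^ 2)) / 2)
        ≤ 768 * ((1 + E) ^ 3)⁻¹ := by
  have hϑc : Continuous (fun t : ℝ => ϑ (E * t ^ 2)) :=
    (k2r_ref_K0_th_continuousOn hϑ).comp_continuous (by fun_prop) fun t => by
      simp only [mem_Ioi]; nlinarith [sq_nonneg t, mul_nonneg hE.le (sq_nonneg t)]
  have hpt : ∀ t ∈ Icc (0:ℝ) 1,
      0 ≤ t * ϑ (E * t ^ 2) * Real.exp (-(E * (1 - t ^ 2)) / 2) ∧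
        t * ϑ (E * t ^ 2) * Real.exp (-(E * (1 - t ^ 2)) / 2)
          ≤ 384 * ((1 + E) ^ 3)⁻¹ * (t * Real.exp (-(E * (1 - t ^ 2)) / 4)) := by
    intro t ht
    have ht2 : t ^ 2 ≤ 1 := by nlinarith [ht.1, ht.2]
    set y := E * (1 - t ^ 2) with hy
    have hy0 : 0 ≤ y := by rw [hy]; exact mul_nonneg hE.le (by linarith)
    have hEt : 0 ≤ E * t ^ 2 := by positivity
    have hϑ1 := k2r_ref_K0_th_le hR hϑ hEt
    have hϑ0 := k2r_ref_K0_th_nonneg hϑ (by linarith : (-1:ℝ) < E * t ^ 2)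
    have hcube := k2r_ref_K0_cube_le_exp hy0
    have hkey : ((1 + E * t ^ 2) ^ 3)⁻¹ ≤ 384 * Real.exp (y / 4) * ((1 + E) ^ 3)⁻¹ := by
      have h1 : (1 + E) ≤ (1 + E * t ^ 2) * (1 + y) := by rw [hy]; nlinarith
      have h2 : (1 + E) ^ 3 ≤ ((1 + E * t ^ 2) * (1 + y)) ^ 3 :=
        pow_le_pow_left₀ (by positivity) h1 3
      rw [mul_pow] at h2
      rw [show 384 * Real.exp (y / 4) * ((1 + E) ^ 3)⁻¹
          = (384 * Real.exp (y / 4)) / (1 + E) ^ 3 by ring,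
        le_div_iff₀ (by positivity), inv_mul_le_iff₀ (by positivity)]
      calc (1 + E) ^ 3 ≤ (1 + E * t ^ 2) ^ 3 * (1 + y) ^ 3 := h2
        _ ≤ (1 + E * t ^ 2) ^ 3 * (384 * Real.exp (y / 4)) := by gcongr
    have hexp : Real.exp (y / 4) * Real.exp (-(E * (1 - t ^ 2)) / 2)
        = Real.exp (-(E * (1 - t ^ 2)) / 4) := by
      rw [← Real.exp_add, hy]; congr 1; ring
    refine ⟨mul_nonneg (mul_nonneg ht.1 hϑ0) (Real.exp_nonneg _), ?_⟩
    calc t * ϑ (E * t ^ 2) * Real.exp (-(E * (1 - t ^ 2)) / 2)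
        ≤ t * (384 * Real.exp (y / 4) * ((1 + E) ^ 3)⁻¹) * Real.exp (-(E * (1 - t ^ 2)) / 2) := by
          gcongr; exact ht.1; exact hϑ1.trans hkey
      _ = 384 * ((1 + E) ^ 3)⁻¹ * (t * (Real.exp (y / 4) * Real.exp (-(E * (1 - t ^ 2)) / 2))) := by
          ring
      _ = 384 * ((1 + E) ^ 3)⁻¹ * (t * Real.exp (-(E * (1 - t ^ 2)) / 4)) := by rw [hexp]
  have hW : ∀ t ∈ uIcc (0:ℝ) 1, HasDerivAt (fun t => 2 / E * Real.exp (-(E * (1 - t ^ 2)) / 4))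
      (t * Real.exp (-(E * (1 - t ^ 2)) / 4)) t := by
    intro t _
    have hin : HasDerivAt (fun t => -(E * (1 - t ^ 2)) / 4) (E * t / 2) t := by
      refine (((((hasDerivAt_id' t).fun_pow 2).const_sub 1).const_mul E).fun_neg.div_const 4
        ).congr_deriv ?_
      ring
    refine (hin.exp.const_mul (2 / E)).congr_deriv ?_
    field_simp
  have hWint : ∫ t in (0:ℝ)..1, t * Real.exp (-(E * (1 - t ^ 2)) / 4)
      = 2 / E * (1 - Real.exp (-E / 4)) := by
    rw [intervalIntegral.integral_eq_sub_of_hasDerivAt hW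
      ((by fun_prop : Continuous fun t => t * Real.exp (-(E * (1 - t ^ 2)) / 4)).intervalIntegrable
        _ _)]
    simp; ring
  have hII : IntervalIntegrable (fun t => t * ϑ (E * t ^ 2) * Real.exp (-(E * (1 - t ^ 2)) / 2))
      volume 0 1 :=
    (Continuous.mul (continuous_id.mul hϑc) (by fun_prop)).intervalIntegrable _ _
  have hII' : IntervalIntegrable (fun t => 384 * ((1 + E) ^ 3)⁻¹
      * (t * Real.exp (-(E * (1 - t ^ 2)) / 4))) volume 0 1 :=
    (by fun_prop : Continuous fun t => 384 * ((1 + E) ^ 3)⁻¹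
      * (t * Real.exp (-(E * (1 - t ^ 2)) / 4))).intervalIntegrable _ _
  refine ⟨intervalIntegral.integral_nonneg zero_le_one fun t ht => (hpt t ht).1, ?_⟩
  have hle := intervalIntegral.integral_mono_on zero_le_one hII hII' fun t ht => (hpt t ht).2
  rw [intervalIntegral.integral_const_mul, hWint] at hle
  have h1m : 1 - Real.exp (-E / 4) ≤ 1 := by linarith [Real.exp_pos (-E / 4)]
  have heq : E * (384 * ((1 + E) ^ 3)⁻¹ * (2 / E * (1 - Real.exp (-E / 4))))
      = 768 * ((1 + E) ^ 3)⁻¹ * (1 - Real.exp (-E / 4)) := by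
    field_simp; ring
  calc E * ∫ t in (0:ℝ)..1, t * ϑ (E * t ^ 2) * Real.exp (-(E * (1 - t ^ 2)) / 2)
      ≤ E * (384 * ((1 + E) ^ 3)⁻¹ * (2 / E * (1 - Real.exp (-E / 4)))) := by gcongr
    _ = 768 * ((1 + E) ^ 3)⁻¹ * (1 - Real.exp (-E / 4)) := heq
    _ ≤ 768 * ((1 + E) ^ 3)⁻¹ * 1 := by gcongr
    _ = 768 * ((1 + E) ^ 3)⁻¹ := mul_one _


/-- **Pointwise bound on the weighted critical kernel.** For `E > 0`, `R > 0`: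
`(1+E) √E |2 g_R(E) - n(√E) ϑ_R(E)| ≤ π (3075 (1+E)⁻² + 96 e^{-E/4} + R⁻¹ e^{-E/R})`, where
`g_R(E) = π ∫_{-1}^{1} e^{-E(1-t²)/2} h(√E t) Θ̄_R(E t²) dt`. [folklore] -/
theorem k2r_ref_K0_pointwise (hR : 0 < R)
    (hϑ : ∀ E, ϑ E = ((1 + E) ^ 3)⁻¹ * Real.exp (-E / R))
    (hΘ : ∀ x, Θ x = ∫ E in Ioi x, ϑ E) {h : ℝ → ℝ} (hh : Continuous h)
    (hb : ∀ a, 0 ≤ h a - max a 0 ∧ h a - max a 0 ≤ Real.exp (-a ^ 2 / 2))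
    {n : ℝ → ℝ} (hn : ∀ u, 0 ≤ u → π * u ≤ n u ∧ n u ≤ π * Real.sqrt (u ^ 2 + 3))
    {E : ℝ} (hE : 0 < E) :
    (1 + E) * Real.sqrt E *
        |2 * (π * ∫ t in (-1:ℝ)..1,
            Real.exp (-(E * (1 - t ^ 2)) / 2) * h (Real.sqrt E * t) * Θ (E * t ^ 2))
          - n (Real.sqrt E) * ϑ E|
      ≤ π * (3075 * ((1 + E) ^ 2)⁻¹ + 96 * Real.exp (-E / 4) + R⁻¹ * Real.exp (-E / R)) := by
  obtain ⟨-, hΘc⟩ := k2r_ref_K0_comp_sq_continuous hR hϑ hΘ hE.le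
  set u := Real.sqrt E with hu
  have hu0 : 0 < u := Real.sqrt_pos.mpr hE
  have hu0' : u ≠ 0 := hu0.ne'
  have hu2 : u ^ 2 = E := Real.sq_sqrt hE.le
  -- the three `t`-integrals
  set I := ∫ t in (-1:ℝ)..1, Real.exp (-(E * (1 - t ^ 2)) / 2) * h (u * t) * Θ (E * t ^ 2) with hI
  set I₀ := ∫ t in (-1:ℝ)..1, Real.exp (-(E * (1 - t ^ 2)) / 2) * max (u * t) 0 * Θ (E * t ^ 2)
    with hI₀
  set Ir := ∫ t in (-1:ℝ)..1, Real.exp (-(E * (1 - t ^ 2)) / 2) * (h (u * t) - max (u * t) 0)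
    * Θ (E * t ^ 2) with hIr
  have hII₀ : IntervalIntegrable (fun t => Real.exp (-(E * (1 - t ^ 2)) / 2) * max (u * t) 0
      * Θ (E * t ^ 2)) volume (-1) 1 := (Continuous.mul (by fun_prop) hΘc).intervalIntegrable _ _
  have hIIr : IntervalIntegrable (fun t => Real.exp (-(E * (1 - t ^ 2)) / 2)
      * (h (u * t) - max (u * t) 0) * Θ (E * t ^ 2)) volume (-1) 1 :=
    (Continuous.mul (by fun_prop) hΘc).intervalIntegrable _ _
  have hsplit : I = I₀ + Ir := by
    rw [hI₀, hIr, ← intervalIntegral.integral_add hII₀ hIIr]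
    refine intervalIntegral.integral_congr fun t _ => ?_
    ring
  set J := ∫ t in (0:ℝ)..1, Θ (E * t ^ 2) * (t * Real.exp (-(E * (1 - t ^ 2)) / 2)) with hJ
  have hmain : I₀ = u * J := k2r_ref_K0_mainpart_split hΘc
  set K := ∫ t in (0:ℝ)..1, t * ϑ (E * t ^ 2) * Real.exp (-(E * (1 - t ^ 2)) / 2) with hK
  have hibp : J = Θ E * E⁻¹ - Θ 0 * (E⁻¹ * Real.exp (-E / 2)) + 2 * K :=
    k2r_ref_K0_ibp hR hϑ hΘ hE
  obtain ⟨hK0, hK1⟩ := k2r_ref_K0_K_bound hR hϑ hE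
  obtain ⟨hIr0, hIr1⟩ := k2r_ref_K0_rpart hR hϑ hΘ hh hb hE.le
  obtain ⟨hS0, hS1⟩ := k2r_ref_K0_Theta_critical hR hϑ hΘ hE.le
  obtain ⟨hΘ00, hΘ01⟩ := k2r_ref_K0_Theta_bounds hR hϑ hΘ le_rfl
  norm_num at hΘ01
  have hϑ1 := k2r_ref_K0_th_le hR hϑ hE.le
  have hϑ0 := k2r_ref_K0_th_nonneg hϑ (by linarith : (-1:ℝ) < E)
  obtain ⟨hn0, hn1⟩ := hn u hu0.le
  -- the critical cancellation: substitute `Θ E`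
  set S := E * ϑ E + ϑ E - 2 * Θ E with hS
  have hΘE : Θ E = (E * ϑ E + ϑ E - S) / 2 := by rw [hS]; ring
  have hQ : (1 + E) * u * (2 * (π * I) - n u * ϑ E)
      = -(((1 + E) * ϑ E) * (u * (n u - π * u)))
        + π * ((1 + E) * ϑ E)
        - π * ((1 + E) * S)
        - 2 * π * Θ 0 * ((1 + E) * Real.exp (-E / 2))
        + 4 * π * ((1 + E) * (E * K))
        + 2 * π * (((1 + E) * u) * Ir) := by
    rw [hsplit, hmain, hibp, hΘE, ← hu2]
    field_simp
    ring
  -- bounds on the six terms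
  have hA0 : 0 ≤ (1 + E) * ϑ E := by positivity
  have hA1 : (1 + E) * ϑ E ≤ ((1 + E) ^ 2)⁻¹ := by
    calc (1 + E) * ϑ E ≤ (1 + E) * ((1 + E) ^ 3)⁻¹ := by gcongr
      _ = ((1 + E) ^ 2)⁻¹ := by field_simp
  have hB0 : 0 ≤ u * (n u - π * u) := mul_nonneg hu0.le (by linarith)
  have hB1 : u * (n u - π * u) ≤ π * (3 / 2) := by
    calc u * (n u - π * u) ≤ u * (π * Real.sqrt (u ^ 2 + 3) - π * u) := by gcongr
      _ = π * (u * (Real.sqrt (u ^ 2 + 3) - u)) := by ring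
      _ ≤ π * (3 / 2) := by gcongr; exact k2r_ref_K0_mul_sqrt_sub_le u
  have h32 := k2r_ref_K0_sq_mul_exp_le hE.le
  have hp1 : 0 ≤ ((1 + E) * ϑ E) * (u * (n u - π * u)) ∧
      ((1 + E) * ϑ E) * (u * (n u - π * u)) ≤ ((1 + E) ^ 2)⁻¹ * (π * (3 / 2)) :=
    ⟨mul_nonneg hA0 hB0, mul_le_mul hA1 hB1 hB0 (by positivity)⟩
  have hp2 : π * ((1 + E) * ϑ E) ≤ π * ((1 + E) ^ 2)⁻¹ := by gcongr
  have hp2' : 0 ≤ π * ((1 + E) * ϑ E) := by positivity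
  have hp3 : π * ((1 + E) * S) ≤ π * (R⁻¹ * Real.exp (-E / R)) := by gcongr
  have hp3' : 0 ≤ π * ((1 + E) * S) := by positivity
  have hX0 : 0 ≤ (1 + E) * Real.exp (-E / 2) := by positivity
  have hX1 : (1 + E) * Real.exp (-E / 2) ≤ 32 * Real.exp (-E / 4) := by
    refine le_trans ?_ h32
    have : (1 + E) ≤ (1 + E) ^ 2 := by nlinarith
    gcongr
  have hp4 : 2 * π * Θ 0 * ((1 + E) * Real.exp (-E / 2)) ≤ π * (32 * Real.exp (-E / 4)) := by
    calc 2 * π * Θ 0 * ((1 + E) * Real.exp (-E / 2))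
        ≤ 2 * π * (1 / 2) * ((1 + E) * Real.exp (-E / 2)) := by gcongr
      _ = π * ((1 + E) * Real.exp (-E / 2)) := by ring
      _ ≤ π * (32 * Real.exp (-E / 4)) := by gcongr
  have hp4' : 0 ≤ 2 * π * Θ 0 * ((1 + E) * Real.exp (-E / 2)) := by positivity
  have hp5 : 4 * π * ((1 + E) * (E * K)) ≤ π * (3072 * ((1 + E) ^ 2)⁻¹) := by
    calc 4 * π * ((1 + E) * (E * K)) ≤ 4 * π * ((1 + E) * (768 * ((1 + E) ^ 3)⁻¹)) := by gcongr
      _ = π * (3072 * ((1 + E) ^ 2)⁻¹) := by field_simp; ring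
  have hp5' : 0 ≤ 4 * π * ((1 + E) * (E * K)) := by positivity
  have hp6 : 2 * π * (((1 + E) * u) * Ir) ≤ π * (64 * Real.exp (-E / 4)) := by
    have hu1 : u ≤ 1 + E := by
      rw [hu, Real.sqrt_le_left (by positivity)]
      calc E ≤ E + (1 + E + E ^ 2) := le_add_of_nonneg_right (by positivity)
        _ = (1 + E) ^ 2 := by ring
    calc 2 * π * (((1 + E) * u) * Ir) ≤ 2 * π * (((1 + E) * (1 + E)) * Real.exp (-E / 2)) := by
          gcongr
      _ = 2 * π * ((1 + E) ^ 2 * Real.exp (-E / 2)) := by ring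
      _ ≤ 2 * π * (32 * Real.exp (-E / 4)) := by gcongr
      _ = π * (64 * Real.exp (-E / 4)) := by ring
  have hp6' : 0 ≤ 2 * π * (((1 + E) * u) * Ir) := by positivity
  have hY : 0 ≤ π * Real.exp (-E / 4) := by positivity
  have hZ : 0 ≤ π * (R⁻¹ * Real.exp (-E / R)) := by positivity
  have hXX : 0 ≤ π * ((1 + E) ^ 2)⁻¹ := by positivity
  -- conclusion
  have hw : 0 ≤ (1 + E) * u := by positivity
  rw [show (1 + E) * u * |2 * (π * I) - n u * ϑ E| = |(1 + E) * u * (2 * (π * I) - n u * ϑ E)| by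
    rw [abs_mul, abs_of_nonneg hw], hQ, abs_le]
  constructor
  · linarith [hp1.1, hp1.2]
  · linarith [hp1.1, hp1.2]

end Gain

/-! ## The dominating function and the registered stub -/

/-- The `R`-uniform part of the dominator integrates to `3075 + 384`, the escaping part
`R⁻¹ e^{-E/R}` to `1`: `∫_0^∞ π (3075 (1+E)⁻² + 96 e^{-E/4} + R⁻¹ e^{-E/R}) dE = 3460 π`. [folklore] -/
theorem k2r_ref_K0_dominator_integral {R : ℝ} (hR : 0 < R) :
    IntegrableOn (fun E => π * (3075 * ((1 + E) ^ 2)⁻¹ + 96 * Real.exp (-E / 4)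
        + R⁻¹ * Real.exp (-E / R))) (Ioi 0) ∧
      ∫ E in Ioi (0:ℝ), π * (3075 * ((1 + E) ^ 2)⁻¹ + 96 * Real.exp (-E / 4)
        + R⁻¹ * Real.exp (-E / R)) = 3460 * π := by
  obtain ⟨i1, h1v⟩ := k2r_ref_K0_integral_const_mul_inv_sq 3075 (by norm_num : (-1:ℝ) < 0)
  have h2f : (fun E : ℝ => Real.exp (-E / 4)) = fun E => Real.exp ((-1 / 4) * E) := by
    funext E; congr 1; ring
  have h2i : IntegrableOn (fun E : ℝ => Real.exp (-E / 4)) (Ioi 0) := by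
    rw [h2f]; exact integrableOn_exp_mul_Ioi (by norm_num) 0
  have h2v : ∫ E in Ioi (0:ℝ), Real.exp (-E / 4) = 4 := by
    rw [h2f, integral_exp_mul_Ioi (by norm_num) 0]; norm_num
  have h3f : (fun E : ℝ => Real.exp (-E / R)) = fun E => Real.exp ((-1 / R) * E) := by
    funext E; congr 1; ring
  have hR' : -1 / R < 0 := div_neg_of_neg_of_pos (by norm_num) hR
  have h3i : IntegrableOn (fun E : ℝ => Real.exp (-E / R)) (Ioi 0) := by
    rw [h3f]; exact integrableOn_exp_mul_Ioi hR' 0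
  have h3v : ∫ E in Ioi (0:ℝ), Real.exp (-E / R) = R := by
    rw [h3f, integral_exp_mul_Ioi hR' 0]
    simp only [mul_zero, Real.exp_zero]
    field_simp
  have i2 : IntegrableOn (fun E : ℝ => 96 * Real.exp (-E / 4)) (Ioi 0) := h2i.const_mul 96
  have i3 : IntegrableOn (fun E : ℝ => R⁻¹ * Real.exp (-E / R)) (Ioi 0) := h3i.const_mul R⁻¹
  have i12 : IntegrableOn (fun E : ℝ => 3075 * ((1 + E) ^ 2)⁻¹ + 96 * Real.exp (-E / 4)) (Ioi 0) :=
    i1.add i2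
  have hsum : IntegrableOn (fun E => 3075 * ((1 + E) ^ 2)⁻¹ + 96 * Real.exp (-E / 4)
      + R⁻¹ * Real.exp (-E / R)) (Ioi 0) := i12.add i3
  refine ⟨hsum.const_mul π, ?_⟩
  rw [integral_const_mul, integral_add i12 i3, integral_add i1 i2, h1v,
    integral_const_mul, integral_const_mul, h2v, h3v]
  field_simp
  norm_num

/-- **Stub `kernelCritical` (K0): criticality of the `ℓ = 0` sector.** For any continuous `h` with
`0 ≤ h(a) - a₊ ≤ e^{-a²/2}` and any measurable loss profile `n` with `πu ≤ n(u) ≤ π√(u²+3)`, the dual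
kernel of the critical weight `ϑ_R(E) = (1+E)⁻³e^{-E/R}`,
`k_R(E) = 2 g_R(E) - n(√E) ϑ_R(E)`, `g_R(E) = π ∫_{-1}^{1} e^{-E(1-t²)/2} h(√E t) Θ̄_R(E t²) dt`,
has `∫₀^∞ (1+E) √E |k_R(E)| dE ≤ 3460 π` for every `R ≥ 1`.  Proof: positive part of `h` lives on
`t ≥ 0`; integration by parts in `t` (`t e^{-E(1-t²)/2} = ∂_t e^{-E(1-t²)/2}/E`) turns the gain into
`(2π/√E) Θ̄_R(E)` plus lower-order terms, and the critical identity
`2Θ̄_R - Eϑ_R = ϑ_R - R⁻¹∫_E^∞(1+x)⁻²e^{-x/R}` cancels it against the loss `π√E ϑ_R(E)`; every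
remainder is dominated by `π(3075(1+E)⁻² + 96e^{-E/4})` except the escaping mass `πR⁻¹e^{-E/R}`
of total integral `π`. -/
theorem stub_kernelCritical :
  let th0 : ℝ → ℝ → ℝ := fun R E => ((1 + E) ^ 3)⁻¹ * Real.exp (-E / R)
  let Tb0 : ℝ → ℝ → ℝ := fun R x => ∫ E in Set.Ioi x, th0 R E
  ∀ h : ℝ → ℝ, Continuous h → (∀ a, 0 ≤ h a - max a 0 ∧ h a - max a 0 ≤ Real.exp (-a ^ 2 / 2)) →
  ∀ n : ℝ → ℝ, Measurable n → (∀ u, 0 ≤ u → Real.pi * u ≤ n u ∧ n u ≤ Real.pi * Real.sqrt (u ^ 2 + 3)) →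
  ∃ M₀ : ℝ, ∀ R : ℝ, 1 ≤ R →
    let g : ℝ → ℝ := fun E => Real.pi * ∫ t in (-1 : ℝ)..1,
      Real.exp (-(E * (1 - t ^ 2)) / 2) * h (Real.sqrt E * t) * Tb0 R (E * t ^ 2)
    IntegrableOn (fun E => (1 + E) * Real.sqrt E * |2 * g E - n (Real.sqrt E) * th0 R E|) (Set.Ioi 0) ∧
    ∫ E in Set.Ioi (0 : ℝ), (1 + E) * Real.sqrt E * |2 * g E - n (Real.sqrt E) * th0 R E| ≤ M₀ := by
  intro th0 Tb0 h hh hb n hn hnb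
  refine ⟨3460 * π, fun R hR => ?_⟩
  intro g
  have hR0 : 0 < R := by linarith
  -- the weight and its tail at scale `R`, pinned by their defining equations
  set ϑ : ℝ → ℝ := th0 R with hϑdef
  have hϑ : ∀ E, ϑ E = ((1 + E) ^ 3)⁻¹ * Real.exp (-E / R) := fun E => rfl
  have hΘ : ∀ x, Tb0 R x = ∫ E in Ioi x, ϑ E := fun x => rfl
  have hϑm : Measurable ϑ := by
    rw [show ϑ = fun E => ((1 + E) ^ 3)⁻¹ * Real.exp (-E / R) from funext hϑ]; fun_prop
  -- an everywhere-continuous version `G` of the gain (`g = π G` on `E ≥ 0`)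
  have hΘc : ContinuousOn (Tb0 R) (Ioi (-1)) := k2r_ref_K0_Theta_continuousOn hR0 hϑ hΘ
  set Θc : ℝ → ℝ := fun x => Tb0 R (max x 0) with hΘcdef
  have hΘcc : Continuous Θc := hΘc.comp_continuous (continuous_id.max continuous_const)
    (fun x => by simp only [mem_Ioi]; exact lt_of_lt_of_le (by norm_num) (le_max_right _ _))
  set G : ℝ → ℝ := fun E => ∫ t in (-1:ℝ)..1,
    Real.exp (-(E * (1 - t ^ 2)) / 2) * h (Real.sqrt E * t) * Θc (E * t ^ 2) with hGdef
  have hGc : Continuous G :=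
    intervalIntegral.continuous_parametric_intervalIntegral_of_continuous' (by fun_prop) (-1) 1
  have hgG : ∀ E, 0 < E → g E = π * G E := by
    intro E hE
    show π * _ = π * _
    congr 1
    refine intervalIntegral.integral_congr fun t _ => ?_
    simp only [hΘcdef]
    rw [max_eq_left (by positivity)]
  -- measurability of the integrand through `G`
  set Φ : ℝ → ℝ := fun E => (1 + E) * Real.sqrt E * |2 * (π * G E) - n (Real.sqrt E) * ϑ E|
    with hΦdef
  have hΦm : Measurable Φ := by
    have : Measurable fun E => n (Real.sqrt E) := hn.comp Real.continuous_sqrt.measurable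
    fun_prop
  have hfm : AEStronglyMeasurable
      (fun E => (1 + E) * Real.sqrt E * |2 * g E - n (Real.sqrt E) * ϑ E|)
      (volume.restrict (Ioi 0)) := by
    refine hΦm.aestronglyMeasurable.congr ?_
    filter_upwards [ae_restrict_mem measurableSet_Ioi] with E hE
    simp only [hΦdef]
    rw [hgG E hE]
  -- domination on `(0, ∞)` by the pointwise bound
  obtain ⟨hDi, hDv⟩ := k2r_ref_K0_dominator_integral hR0
  have hbd : ∀ᵐ E ∂(volume.restrict (Ioi (0:ℝ))),
      ‖(1 + E) * Real.sqrt E * |2 * g E - n (Real.sqrt E) * ϑ E|‖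
        ≤ π * (3075 * ((1 + E) ^ 2)⁻¹ + 96 * Real.exp (-E / 4) + R⁻¹ * Real.exp (-E / R)) := by
    filter_upwards [ae_restrict_mem measurableSet_Ioi] with E hE
    have hE0 : (0:ℝ) < E := hE
    rw [Real.norm_eq_abs, abs_of_nonneg (by positivity)]
    exact k2r_ref_K0_pointwise hR0 hϑ hΘ hh hb hnb hE0
  have hfi : IntegrableOn (fun E => (1 + E) * Real.sqrt E * |2 * g E - n (Real.sqrt E) * ϑ E|)
      (Ioi 0) := hDi.mono' hfm hbd
  refine ⟨hfi, ?_⟩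
  calc ∫ E in Ioi (0:ℝ), (1 + E) * Real.sqrt E * |2 * g E - n (Real.sqrt E) * ϑ E|
      ≤ ∫ E in Ioi (0:ℝ), π * (3075 * ((1 + E) ^ 2)⁻¹ + 96 * Real.exp (-E / 4)
          + R⁻¹ * Real.exp (-E / R)) := by
        refine integral_mono_ae hfi hDi ?_
        filter_upwards [hbd] with E hE
        exact le_trans (le_abs_self _) ((Real.norm_eq_abs _).symm.le.trans hE)
    _ = 3460 * π := hDv

end Summit.AtomisticToContinuum.HydrodynamicLimit.Theorems.EnskogAdjointDuality
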